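import Summits.KontsevichZagierPeriods.KontsevichZagierPeriods.Theorems.TerasomaMultiplicationBetaCancellationDivisorSlicingOneBijectionRelation
import Summits.KontsevichZagierPeriods.KontsevichZagierPeriods.Theorems.CompiledSubstitutionsPiNormalisation
import Summits.KontsevichZagierPeriods.KontsevichZagierPeriods.Theorems.TerasomaMultiplicationBetaCancellationStubTameForm
import Summits.KontsevichZagierPeriods.KontsevichZagierPeriods.Theorems.TerasomaMultiplicationBetaCancellationOfPiCancellation
import Literature.NumberTheory.Transcendental.KZCalculusProofs
import Literature.NumberTheory.Transcendental.KZProductIdeal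

/-!
# `KZ.PiCancellation` ⟺ one-bijection descent ⟺ `BetaCancellation`

Line `divisor-slicing-transshipment` of crux `BetaCancellation` (stmt-KontsevichZagierPeriods-13633).
`OneBijectionDescent` := for all positive `A`, `B` and every one-bijection form `K × A ≅ K × B`
(`K` the Cauchy line), `A ∼ B`. `PiCancellation → OneBijectionDescent` (a one-bijection form is a
certificate, `oneBijection_prod_sub_prod_mem_relations`, then cancel); `OneBijectionDescent →
PiCancellation` (every certificate `[K × r] − [K × r'] ∈ relations` has a one-bijection normal form,
`stub_tameForm` — the F13 normal form of crux NOTES c6, landed by the line's worker, 26 files — then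
descend). Hence the crux `BetaCancellation` (≡ `PiCancellation`, `betaCancellation_iff_piCancellation`)
is EQUIVALENT to one-bijection descent: item 0540 is exactly "the disc cancels from every finite
piecewise `ℚ`-semialgebraic measure isomorphism `K × A ≅ K × B`" — the one-bijection open core of
crux NOTES c12 I1 / c13 J2 / c15 L6, now a tree theorem.
-/

noncomputable section

set_option linter.dupNamespace false

open MeasureTheory Set Filter
open Literature.NumberTheory.Transcendental
open Literature.NumberTheory.Transcendental.KZ
open Literature.ModelTheory.ExponentialFields (IsSemialgebraic isSemialgebraic_univ)

namespace Summit.KontsevichZagierPeriods.KontsevichZagierPeriods.BetaCancellationDivisorSlicing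

/-- **`PiCancellation` gives one-bijection descent**: granted `KZ.PiCancellation`, every
one-bijection form between `K × A` and `K × B` (`K` any Cauchy-line representation) yields `A ∼ B`.
CONDITIONAL on `KZ.PiCancellation` (item 0540). [folklore] -/
theorem oneBijectionDescent_of_piCancellation (hπ : KZ.PiCancellation) (d : ℕ) (A B : IntegralRep d)
    (K : IntegralRep 1) (hKd : K.domain = Set.univ)
    (hKi : Set.EqOn K.integrand (fun x => 1 / (1 + x 0 ^ 2)) K.domain) (J : ℕ)
    (S : Fin J → Set (Fin (1 + d) → ℝ)) (Ψ : Fin J → (Fin (1 + d) → ℝ) → (Fin (1 + d) → ℝ))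
    (Ψ' : Fin J → (Fin (1 + d) → ℝ) → ((Fin (1 + d) → ℝ) →L[ℝ] (Fin (1 + d) → ℝ)))
    (h : (∀ j, IsSemialgebraic ℚ (S j) ∧ S j ⊆ {z | (fun i => z (Fin.natAdd 1 i)) ∈ A.domain} ∧
        IsSemialgebraicMapOn ℚ (S j) (Ψ j) ∧ Set.InjOn (Ψ j) (S j) ∧
        (∀ z ∈ S j, HasFDerivWithinAt (Ψ j) (Ψ' j z) (S j) z) ∧
        Ψ j '' S j ⊆ {z | (fun i => z (Fin.natAdd 1 i)) ∈ B.domain} ∧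
        ∀ z ∈ S j, 1 / (1 + z (Fin.castAdd d 0) ^ 2) * A.integrand (fun i => z (Fin.natAdd 1 i)) =
          1 / (1 + (Ψ j z) (Fin.castAdd d 0) ^ 2) * B.integrand (fun i => (Ψ j z) (Fin.natAdd 1 i)) *
            |(Ψ' j z).det|) ∧
      (∀ j j', j ≠ j' → volume (S j ∩ S j') = 0 ∧ volume (Ψ j '' S j ∩ Ψ j' '' S j') = 0) ∧
      volume ({z : Fin (1 + d) → ℝ | (fun i => z (Fin.natAdd 1 i)) ∈ A.domain} \ ⋃ j, S j) = 0 ∧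
      volume ({z : Fin (1 + d) → ℝ | (fun i => z (Fin.natAdd 1 i)) ∈ B.domain} \ ⋃ j, Ψ j '' S j) = 0) :
    Equivalent A B := by
  have hrel := oneBijection_prod_sub_prod_mem_relations d A B K hKd hKi J S Ψ Ψ' h
  have hKπ : Equivalent K piRep :=
    (Summit.KontsevichZagierPeriods.CompiledSubstitutions.PiNormalisation.piNormalisation_proof
      piRep rfl (fun _ _ => rfl)).1 K hKd hKi
  exact equivalent_of_oneBijection_of_piCancellation hπ A B K hKπ hrel

/-- **One-bijection descent gives `PiCancellation`**: if every one-bijection form between catalytic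
products `K × A ≅ K × B` (`A`, `B` positive) descends to `A ∼ B`, then `[π]` is a non-zero-divisor on
formal periods — reduce `c` to `[r] − [r']`, trade the disc for the Cauchy line, put the certificate in
one-bijection normal form (`stub_tameForm`), descend. [folklore] -/
theorem piCancellation_of_oneBijectionDescent
    (hD : ∀ (d : ℕ) (A B : IntegralRep d), (∀ a ∈ A.domain, 0 < A.integrand a) → (∀ b ∈ B.domain, 0 < B.integrand b) → ∀ (J : ℕ) (S : Fin J → Set (Fin (1 + d) → ℝ)) (Ψ : Fin J → (Fin (1 + d) → ℝ) → (Fin (1 + d) → ℝ)) (Ψ' : Fin J → (Fin (1 + d) → ℝ) → ((Fin (1 + d) → ℝ) →L[ℝ] (Fin (1 + d) → ℝ))), ((∀ j, IsSemialgebraic ℚ (S j) ∧ S j ⊆ {z | (fun i => z (Fin.natAdd 1 i)) ∈ A.domain} ∧ IsSemialgebraicMapOn ℚ (S j) (Ψ j) ∧ Set.InjOn (Ψ j) (S j) ∧ (∀ z ∈ S j, HasFDerivWithinAt (Ψ j) (Ψ' j z) (S j) z) ∧ Ψ j '' S j ⊆ {z | (fun i => z (Fin.natAdd 1 i)) ∈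 B.domain} ∧ ∀ z ∈ S j, 1 / (1 + z (Fin.castAdd d 0) ^ 2) * A.integrand (fun i => z (Fin.natAdd 1 i)) = 1 / (1 + (Ψ j z) (Fin.castAdd d 0) ^ 2) * B.integrand (fun i => (Ψ j z) (Fin.natAdd 1 i)) * |(Ψ' j z).det|) ∧ (∀ j j', j ≠ j' → volume (S j ∩ S j') = 0 ∧ volume (Ψ j '' S j ∩ Ψ j' '' S j') = 0) ∧ volume ({z : Fin (1 + d) → ℝ | (fun i => z (Fin.natAdd 1 i)) ∈ A.domain} \ ⋃ j, S j) = 0 ∧ volume ({z : Fin (1 + d) → ℝ | (fun i => z (Fin.natAdd 1 i)) ∈ B.domain} \ ⋃ j, Ψ j '' S j) = 0) → Equivalent A B) :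
    KZ.PiCancellation := by
  intro c hc
  obtain ⟨n, m, r, r', hcr⟩ := exists_integralRep_sub_holds c
  -- a Cauchy-line representation
  have hu : IsSemialgebraic ℚ (Set.univ : Set (Fin 1 → ℝ)) := isSemialgebraic_univ
  have hf : IsSemialgebraicFunOn ℚ (Set.univ : Set (Fin 1 → ℝ)) (fun x => 1 / (1 + x 0 ^ 2)) := by
    have h := isSemialgebraicFunOn_aeval_div_aeval hu
      (1 : MvPolynomial (Fin 1) ℚ) (1 + MvPolynomial.X 0 ^ 2) (fun x _ => by
        simp only [map_add, map_one, map_pow, MvPolynomial.aeval_X]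
        positivity)
    exact h.congr fun x _ => by
      simp only [map_add, map_one, map_pow, MvPolynomial.aeval_X]
  have hi : IntegrableOn (fun x : Fin 1 → ℝ => 1 / (1 + x 0 ^ 2)) Set.univ := by
    rw [integrableOn_univ]
    have hg : Integrable (fun t : ℝ => 1 / (1 + t ^ 2)) := by
      refine integrable_inv_one_add_sq.congr (Filter.Eventually.of_forall fun t => ?_)
      simp only [one_div]
    exact ((volume_preserving_funUnique (Fin 1) ℝ).integrable_comp_emb
      (MeasurableEquiv.measurableEmbedding _)).mpr hg
  set K : IntegralRep 1 := ⟨Set.univ, fun x => 1 / (1 + x 0 ^ 2), hu, hf, hi⟩ with hK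
  have hKd : K.domain = Set.univ := rfl
  have hKi : Set.EqOn K.integrand (fun x => 1 / (1 + x 0 ^ 2)) K.domain := fun _ _ => rfl
  have hKπ : Equivalent K piRep :=
    (Summit.KontsevichZagierPeriods.CompiledSubstitutions.PiNormalisation.piNormalisation_proof
      piRep rfl (fun _ _ => rfl)).1 K hKd hKi
  -- `[π]·([r] − [r']) ∈ relations`, then trade the disc for the Cauchy line
  have h1 : of piRep * (of r - of r') ∈ relations := by
    have h' : of piRep * (c - (of r - of r')) ∈ relations := piRep_mul_mem_relations hcr
    have h'' := relations.sub_mem hc h'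
    have : of piRep * (of r - of r') = of piRep * c - of piRep * (c - (of r - of r')) := by
      simp only [mul_sub]; abel
    rw [this]; exact h''
  have h2 : of (K.prod r) - of (K.prod r') ∈ relations := by
    have hr : Equivalent (K.prod r) (piRep.prod r) := hKπ.prod (Equivalent.refl r)
    have hr' : Equivalent (K.prod r') (piRep.prod r') := hKπ.prod (Equivalent.refl r')
    have hπ : of (piRep.prod r) - of (piRep.prod r') ∈ relations := by
      rwa [mul_sub, of_mul_of, of_mul_of] at h1
    have hsum := relations.add_mem (relations.add_mem hr hπ) (relations.neg_mem hr')
    have : of (K.prod r) - of (K.prod r') =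
        of (K.prod r) - of (piRep.prod r) + (of (piRep.prod r) - of (piRep.prod r')) +
          -(of (K.prod r') - of (piRep.prod r')) := by abel
    rw [this]; exact hsum
  -- tame form, descent, conclusion
  obtain ⟨d, A, B, hA, hB, hrel, J, S, Ψ, Ψ', hΨ, hdisj, hcovA, hcovB⟩ := stub_tameForm r r' K hKd hKi h2
  have hAB : Equivalent A B := hD d A B hA hB J S Ψ Ψ' ⟨hΨ, hdisj, hcovA, hcovB⟩
  have h3 : of r - of r' ∈ relations := by
    have hsum := relations.add_mem hrel hAB
    have : of r - of r' = of r - of r' - (of A - of B) + (of A - of B) := by abel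
    rw [this]; exact hsum
  have : c = c - (of r - of r') + (of r - of r') := by abel
  rw [this]
  exact relations.add_mem hcr h3

/-- **`KZ.PiCancellation` ⟺ one-bijection descent.** Item 0540 is equivalent to: for all positive
`A`, `B : IntegralRep d` and every finite piecewise `ℚ`-semialgebraic measure isomorphism between
`K × A` and `K × B` (`K = [ℝ, 1/(1+x²)]`; pieces, injective differentiable semialgebraic maps with the
Jacobian identity, a.e. disjoint, a.e. covering), `A ∼ B`. [folklore] -/
theorem piCancellation_iff_oneBijectionDescent : KZ.PiCancellation ↔ (∀ (d : ℕ) (A B : IntegralRep d), (∀ a ∈ A.domain, 0 < A.integrand a) → (∀ b ∈ B.domain, 0 < B.integrand b) → ∀ (J : ℕ) (S : Fin J → Set (Fin (1 + d) → ℝ)) (Ψ : Fin J → (Fin (1 + d) → ℝ) → (Fin (1 + d) → ℝ)) (Ψ' : Fin J → (Fin (1 + d) → ℝ) → ((Fin (1 + d) → ℝ) →L[ℝ] (Fin (1 + d) → ℝ))), ((∀ j, IsSemialgebraic ℚ (S j) ∧ S j ⊆ {z | (fun i => z (Fin.natAdd 1 i)) ∈ A.domain} ∧ IsSemialgebraicMapOn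 ℚ (S j) (Ψ j) ∧ Set.InjOn (Ψ j) (S j) ∧ (∀ z ∈ S j, HasFDerivWithinAt (Ψ j) (Ψ' j z) (S j) z) ∧ Ψ j '' S j ⊆ {z | (fun i => z (Fin.natAdd 1 i)) ∈ B.domain} ∧ ∀ z ∈ S j, 1 / (1 + z (Fin.castAdd d 0) ^ 2) * A.integrand (fun i => z (Fin.natAdd 1 i)) = 1 / (1 + (Ψ j z) (Fin.castAdd d 0) ^ 2) * B.integrand (fun i => (Ψ j z) (Fin.natAdd 1 i)) * |(Ψ' j z).det|) ∧ (∀ j j', j ≠ j' → volume (S j ∩ S j') = 0 ∧ volume (Ψ j '' S j ∩ Ψ j' '' S j') = 0) ∧ volume ({z : Fin (1 + d) → ℝ | (fun i => z (Fin.natAdd 1 i)) ∈ A.domain} \ ⋃ j, S j) = 0 ∧ volume ({z : Fin (1 + d) → ℝ | (fun i => z (Fin.natAdd 1 i)) ∈ B.domain} \ ⋃ j, Ψ j '' S j) = 0) → Equivalent A B) := by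
  constructor
  · intro hπ d A B _ _ J S Ψ Ψ' h
    obtain ⟨K, hKd, hKi⟩ : ∃ K : IntegralRep 1, K.domain = Set.univ ∧
        Set.EqOn K.integrand (fun x => 1 / (1 + x 0 ^ 2)) K.domain := by
      have hu : IsSemialgebraic ℚ (Set.univ : Set (Fin 1 → ℝ)) := isSemialgebraic_univ
      have hf : IsSemialgebraicFunOn ℚ (Set.univ : Set (Fin 1 → ℝ)) (fun x => 1 / (1 + x 0 ^ 2)) := by
        have h := isSemialgebraicFunOn_aeval_div_aeval hu
          (1 : MvPolynomial (Fin 1) ℚ) (1 + MvPolynomial.X 0 ^ 2) (fun x _ => by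
            simp only [map_add, map_one, map_pow, MvPolynomial.aeval_X]
            positivity)
        exact h.congr fun x _ => by
          simp only [map_add, map_one, map_pow, MvPolynomial.aeval_X]
      have hi : IntegrableOn (fun x : Fin 1 → ℝ => 1 / (1 + x 0 ^ 2)) Set.univ := by
        rw [integrableOn_univ]
        have hg : Integrable (fun t : ℝ => 1 / (1 + t ^ 2)) := by
          refine integrable_inv_one_add_sq.congr (Filter.Eventually.of_forall fun t => ?_)
          simp only [one_div]
        exact ((volume_preserving_funUnique (Fin 1) ℝ).integrable_comp_emb
          (MeasurableEquiv.measurableEmbedding _)).mpr hg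
      exact ⟨⟨Set.univ, fun x => 1 / (1 + x 0 ^ 2), hu, hf, hi⟩, rfl, fun _ _ => rfl⟩
    exact oneBijectionDescent_of_piCancellation hπ d A B K hKd hKi J S Ψ Ψ' h
  · exact piCancellation_of_oneBijectionDescent

/-- **The crux `BetaCancellation` ⟺ one-bijection descent** (through
`BetaCancellationLine.betaCancellation_iff_piCancellation`). [folklore] -/
theorem betaCancellation_iff_oneBijectionDescent :
    Summit.KontsevichZagierPeriods.KontsevichZagierPeriods.Theses.TerasomaMultiplication.BetaCancellation ↔
      (∀ (d : ℕ) (A B : IntegralRep d), (∀ a ∈ A.domain, 0 < A.integrand a) → (∀ b ∈ B.domain, 0 < B.integrand b) → ∀ (J : ℕ) (S : Fin J → Set (Fin (1 + d) → ℝ)) (Ψ : Fin J → (Fin (1 + d) → ℝ) → (Fin (1 + d) → ℝ)) (Ψ' : Fin J → (Fin (1 + d) → ℝ) → ((Fin (1 + d) → ℝ) →L[ℝ] (Fin (1 + d) → ℝ))), ((∀ j, IsSemialgebraic ℚ (S j) ∧ S j ⊆ {z | (fun i => z (Fin.natAdd 1 i)) ∈ A.domain} ∧ IsSemialgebraicMapOn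 ℚ (S j) (Ψ j) ∧ Set.InjOn (Ψ j) (S j) ∧ (∀ z ∈ S j, HasFDerivWithinAt (Ψ j) (Ψ' j z) (S j) z) ∧ Ψ j '' S j ⊆ {z | (fun i => z (Fin.natAdd 1 i)) ∈ B.domain} ∧ ∀ z ∈ S j, 1 / (1 + z (Fin.castAdd d 0) ^ 2) * A.integrand (fun i => z (Fin.natAdd 1 i)) = 1 / (1 + (Ψ j z) (Fin.castAdd d 0) ^ 2) * B.integrand (fun i => (Ψ j z) (Fin.natAdd 1 i)) * |(Ψ' j z).det|) ∧ (∀ j j', j ≠ j' → volume (S j ∩ S j') = 0 ∧ volume (Ψ j '' S j ∩ Ψ j' '' S j') = 0) ∧ volume ({z : Fin (1 + d) → ℝ | (fun i => z (Fin.natAdd 1 i)) ∈ A.domain} \ ⋃ j, S j) = 0 ∧ volume ({z : Fin (1 + d) → ℝ | (fun i => z (Fin.natAdd 1 i)) ∈ B.domain} \ ⋃ j, Ψ j '' S j) = 0) → Equivalent A B) :=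
  Summit.KontsevichZagierPeriods.KontsevichZagierPeriods.BetaCancellationLine.betaCancellation_iff_piCancellation.trans
    piCancellation_iff_oneBijectionDescent

end Summit.KontsevichZagierPeriods.KontsevichZagierPeriods.BetaCancellationDivisorSlicing

end
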